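import Literature.MathematicalPhysics.QuantumLattice.HubbardCTScaleZeroDetBound
import HarnessLib

/-!
# Every NORMAL covariance on the `4M` time grid is determinant-bounded by the mode-averaged `ℓ¹` distance of its symbol to the
# chronological propagator (de Siqueira Pedra–Salmhofer 2008, Thm 1.3 / 2.4) — the symbol-generic form of `HubbardCTScaleZeroDetBound`

Topic `MathematicalPhysics/QuantumLattice`; cell gate-hubbard-kl, K3 engine two-leg lane, repair (ρ2)(iii) (the Gram/determinant constant of
the K-RESUMMED scale-`0` covariance `C̃^K_{>e₀} = normalCovariance (Ψ/(1 + Ψ·K/(βL²)))`, `HubbardCounterQuadraticResummation`).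
`HubbardCTScaleZeroDetBound.isDetBoundedR_gridSub_hubbardCovAboveCT` bounds the grid pull-back of the CT cutoff covariance
`normalCovariance (βL²·w^K_Λ/(−iν + e_K))` through `MatsubaraTruncationGridGram.norm_det_truncatedPropagator_grid_add_symbol_le`, whose
only covariance-specific input is the mode-averaged `ℓ¹` norm of the remainder `r = symbol/(βL²) − 1/(−iν + ξ)` after the chronological
kernel `1/(−iν + ξ)` is split off.  Here the same proof is run for an ARBITRARY spin-independent symbol `p₀` and an ARBITRARY real band
`E` in the chronological part:

* **`isDetBoundedR_gridSub_normalCovariance`** — `(βL²)⁻¹ Σ_k ‖p₀(k)/(βL²) − 1/(−iν_k + E(k⃗))‖ ≤ κ²` ⇒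
  `IsDetBoundedR q ((hubbardGridSub …)ᵀ · normalCovariance (p₀ ∘ fst) · hubbardGridSub …) √(2(7 + κ²))`, every `M`, no `log M`.

Everything is PROVED; no definitions, no named facts.

## Sources

W. de Siqueira Pedra, M. Salmhofer, Comm. Math. Phys. 282 (2008) 797–818, Thm 1.3, Thm 2.4, Lemma 4.1 [`PedraSalmhofer2008`];
G. Benfatto, A. Giuliani, V. Mastropietro, Ann. Henri Poincaré 7 (2006) 809–898, §2.8 (2.80) [`BenfattoGiulianiMastropietro2006`].
-/

noncomputable section

open Finset

open scoped InnerProductSpace ComplexConjugate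

namespace Literature.MathematicalPhysics.QuantumLattice

open Literature.Probability.LatticeModels GrassmannAlgebra

section Main

variable {L M : ℕ} [NeZero L]

/-- For an antisymmetric covariance the two-point function is `-C(X, Y)`. [cite: BenfattoGiulianiMastropietro2006, §2.1 (2.3)] -/
private theorem contr_apply_of_transpose_eq_neg'' {Γ : Type*} {A : Matrix Γ Γ ℂ} (h : A.transpose = -A) (X Y : Γ) :
    contr ℂ A X Y = -A X Y := by
  have h1 : A Y X = -A X Y := by
    have := congrFun (congrFun h X) Y
    rwa [Matrix.transpose_apply, Matrix.neg_apply] at this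
  rw [contr_apply, h1, Rat.smul_one_eq_cast]
  push_cast
  ring

/-- **Any NORMAL covariance on the `4M` grid is determinant-bounded by the mode-averaged `ℓ¹` distance of its symbol to the chronological
propagator** (de Siqueira Pedra–Salmhofer 2008, Thm 1.3 / 2.4, in the form `norm_det_truncatedPropagator_grid_add_symbol_le` consumes): for
`0 < β`, `0 < M`, a spin-independent symbol `p₀ : FreqMomentum → ℂ`, ANY real band `E : TorusSite 2 L → ℝ`, and any `κ` with
`(βL²)⁻¹ Σ_{(i',k⃗)} ‖p₀(i',k⃗)/(βL²) − 1/(−iν_{i'} + E(k⃗))‖ ≤ κ²`, the pulled-back covariance of the grid fields satisfies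
`IsDetBoundedR q (Sᵀ · normalCovariance (p₀ ∘ fst) · S) √(2(7 + κ²))`.  (`HubbardCTScaleZeroDetBound.isDetBoundedR_gridSub_hubbardCovAboveCT`
is the case `p₀ = βL²·w^K_Λ/(−iν + e_K)`, `E = e_K`, remainder `−(1 − w)/(−iν + e_K)`; the K-RESUMMED scale-`0` covariance of the two-leg lane,
`p₀ = βL²·w/(−iν + e_K + wK)`, is the case this generalisation is written for.) [cite: PedraSalmhofer2008, Thm 1.3] -/
theorem isDetBoundedR_gridSub_normalCovariance {β : ℝ} (hβ : 0 < β) (E : TorusSite 2 L → ℝ) (p₀ : FreqMomentum L M → ℂ) [NeZero M]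
    {κ : ℝ}
    (hIR : 1 / (β * (L : ℝ) ^ 2) * ∑ k : FreqMomentum L M,
        ‖p₀ k / ((β * (L : ℝ) ^ 2 : ℝ) : ℂ) - 1 / (-((matsubaraFreq β M k.1 : ℝ) : ℂ) * Complex.I + (E k.2 : ℂ))‖ ≤ κ ^ 2) :
    IsDetBoundedR (fun X : GridLeg (GridPoint L (2 * (2 * M))) => decide (X.2 = 0))
      ((hubbardGridSub L M β (2 * (2 * M))).transpose * normalCovariance L M (fun ks => p₀ ks.1) *
        hubbardGridSub L M β (2 * (2 * M)))
      (Real.sqrt (2 * (7 + κ ^ 2))) := by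
  intro n a u u' hu hu' Xb Xu hb hub
  have hXb : ∀ i, (Xb i).2 = 0 := fun i => of_decide_eq_true (hb i)
  have hXu : ∀ j, (Xu j).2 = 1 := fun j => Fin.eq_one_of_ne_zero _ (of_decide_eq_false (hub j))
  have hL : (0 : ℝ) < L := by exact_mod_cast Nat.pos_of_ne_zero (NeZero.ne L)
  have hLc : (L : ℂ) ≠ 0 := by exact_mod_cast hL.ne'
  have hβc : (β : ℂ) ≠ 0 := by exact_mod_cast hβ.ne'
  have hβL : (0 : ℝ) < β * (L : ℝ) ^ 2 := by positivity
  have hβLc : ((β * (L : ℝ) ^ 2 : ℝ) : ℂ) ≠ 0 := by exact_mod_cast hβL.ne'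
  simp only [hubbardGridSub]
  set p : FreqMomentum L M × Fin 2 → ℂ := fun ks => p₀ ks.1 with hp
  -- the data in the form of `norm_det_truncatedPropagator_grid_add_symbol_le` (its rows = our charge-`1` columns)
  set ξ : (TorusSite 2 L × Fin 2) × Fin n → ℝ := fun m => E m.1.1 with hξ
  set r0 : TorusSite 2 L → MatsubaraIdx M → ℂ := fun kv i' =>
    p₀ (i', kv) / ((β * (L : ℝ) ^ 2 : ℝ) : ℂ) - 1 / (-((matsubaraFreq β M i' : ℝ) : ℂ) * Complex.I + (E kv : ℂ)) with hr0
  set r : (TorusSite 2 L × Fin 2) × Fin n → MatsubaraIdx M → ℂ := fun m i' => r0 m.1.1 i' with hr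
  set ea : Fin a → TorusSite 2 L → ℂ := fun j kv => ((1 / (L : ℝ) : ℝ) : ℂ) *
    Complex.exp (-(((∑ l, latticeMomentum L kv l * (((Xu j).1.1.2 l).val : ℝ) : ℝ) : ℂ) * Complex.I)) with hea
  set eb : Fin a → TorusSite 2 L → ℂ := fun i kv => ((1 / (L : ℝ) : ℝ) : ℂ) *
    Complex.exp (((∑ l, latticeMomentum L kv l * (((Xb i).1.1.2 l).val : ℝ) : ℝ) : ℂ) * Complex.I) with heb
  set Ff : Fin a → (TorusSite 2 L × Fin 2) × Fin n → ℂ := fun j m =>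
    -(1 * ((if m.1.2 = (Xu j).1.2 then 1 else 0) * ea j m.1.1) * ((u' j m.2 : ℝ) : ℂ)) with hFf
  set Gf : Fin a → (TorusSite 2 L × Fin 2) × Fin n → ℂ := fun i m =>
    ((if m.1.2 = (Xb i).1.2 then 1 else 0) * eb i m.1.1) * ((u i m.2 : ℝ) : ℂ) with hGf
  set Kt : Fin a → Fin a → TorusSite 2 L → ℂ := fun j i kv =>
    ((1 / β : ℝ) : ℂ) * ∑ i' : MatsubaraIdx M,
      Complex.exp (-((matsubaraFreq β M i' *
        (gridTime β (2 * (2 * M)) (Xu j).1.1.1 - gridTime β (2 * (2 * M)) (Xb i).1.1.1) : ℝ) : ℂ) * Complex.I) *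
        (1 / (-((matsubaraFreq β M i' : ℝ) : ℂ) * Complex.I + (E kv : ℂ)) + r0 kv i') with hKt
  -- (1) the symbol identity `1/(-iν+E) + r = p₀/(βL²)` (definition of `r`)
  have hνne : ∀ i' : MatsubaraIdx M, matsubaraFreq β M i' ≠ 0 := fun i' => matsubaraFreq_ne_zero hβ.ne' i'
  have hden : ∀ (i' : MatsubaraIdx M) (kv : TorusSite 2 L),
      (-((matsubaraFreq β M i' : ℝ) : ℂ) * Complex.I + (E kv : ℂ)) ≠ 0 := by
    intro i' kv h
    have := congrArg Complex.im h
    simp at this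
    exact hνne i' (by linarith)
  have hsym : ∀ (i' : MatsubaraIdx M) (kv : TorusSite 2 L),
      1 / (-((matsubaraFreq β M i' : ℝ) : ℂ) * Complex.I + (E kv : ℂ)) + r0 kv i' =
        p₀ (i', kv) / ((β * (L : ℝ) ^ 2 : ℝ) : ℂ) := by
    intro i' kv
    simp only [hr0]
    ring
  have hpsym : ∀ (i' : MatsubaraIdx M) (kv : TorusSite 2 L) (s : Fin 2),
      p ((i', kv), s) = ((β * (L : ℝ) ^ 2 : ℝ) : ℂ) * (p₀ (i', kv) / ((β * (L : ℝ) ^ 2 : ℝ) : ℂ)) := by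
    intro i' kv s
    simp only [hp]
    field_simp
  -- the entry of the pulled-back covariance, charge-0 row `i`, charge-1 column `j`
  have hentry0 : ∀ i j,
      ((gridSubMatrix L M β (fun q : GridPoint L (2 * (2 * M)) => q.2) (fun q => gridTime β (2 * (2 * M)) q.1)).transpose *
          normalCovariance L M p *
          gridSubMatrix L M β (fun q : GridPoint L (2 * (2 * M)) => q.2) (fun q => gridTime β (2 * (2 * M)) q.1)) (Xb i) (Xu j) =
        if (Xb i).1.2 = (Xu j).1.2 then ∑ k : FreqMomentum L M, ((1 / (β * (L : ℝ) ^ 2) : ℝ) : ℂ) ^ 2 *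
          (Complex.exp (((vertexPhase L M β k (Xb i).1.1.2 (gridTime β (2 * (2 * M)) (Xb i).1.1.1) -
              vertexPhase L M β k (Xu j).1.1.2 (gridTime β (2 * (2 * M)) (Xu j).1.1.1) : ℝ) : ℂ) * Complex.I) * p (k, (Xb i).1.2))
        else 0 := by
    intro i j
    have hXbeq : Xb i = (((Xb i).1.1, (Xb i).1.2), 0) := by rw [← hXb i]
    have hXueq : Xu j = (((Xu j).1.1, (Xu j).1.2), 1) := by rw [← hXu j]
    conv_lhs => rw [hXbeq, hXueq]
    exact gridSub_pullback_normalCovariance_apply_zero_one β _ _ p (Xb i).1.1 (Xu j).1.1 (Xb i).1.2 (Xu j).1.2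
  -- (2) `E i j = T j i`
  have hT : ∀ i j, ((⟪u i, u' j⟫_ℝ : ℝ) : ℂ) *
      contr ℂ ((gridSubMatrix L M β (fun q : GridPoint L (2 * (2 * M)) => q.2) (fun q => gridTime β (2 * (2 * M)) q.1)).transpose *
        normalCovariance L M p *
        gridSubMatrix L M β (fun q : GridPoint L (2 * (2 * M)) => q.2) (fun q => gridTime β (2 * (2 * M)) q.1)) (Xb i) (Xu j) =
      ∑ m, Ff j m * Gf i m * Kt j i m.1.1 := by
    intro i j
    rw [contr_apply_of_transpose_eq_neg'' (gridSub_pullback_normalCovariance_transpose β _ _ p) (Xb i) (Xu j), hentry0]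
    have hmode := sum_frozen_modes_eq (L := L) (n := n) 1 (Xu j).1.2 (Xb i).1.2 (ea j) (eb i) (Kt j i) (u' j) (u i)
    simp only [hFf, hGf]
    rw [hmode, one_mul, real_inner_comm (u i) (u' j)]
    by_cases hσ : (Xb i).1.2 = (Xu j).1.2
    · rw [if_pos hσ, if_pos hσ.symm, one_mul]
      have hsum : ∑ k : FreqMomentum L M, ((1 / (β * (L : ℝ) ^ 2) : ℝ) : ℂ) ^ 2 *
          (Complex.exp (((vertexPhase L M β k (Xb i).1.1.2 (gridTime β (2 * (2 * M)) (Xb i).1.1.1) -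
              vertexPhase L M β k (Xu j).1.1.2 (gridTime β (2 * (2 * M)) (Xu j).1.1.1) : ℝ) : ℂ) * Complex.I) *
            p (k, (Xb i).1.2)) =
          ∑ kv, ea j kv * eb i kv * Kt j i kv := by
        rw [Fintype.sum_prod_type, sum_comm]
        refine sum_congr rfl fun kv _ => ?_
        simp only [hKt]
        rw [mul_sum, mul_sum]
        refine sum_congr rfl fun i' _ => ?_
        rw [hsym, hpsym]
        have hexp : Complex.exp (((vertexPhase L M β (i', kv) (Xb i).1.1.2 (gridTime β (2 * (2 * M)) (Xb i).1.1.1) -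
            vertexPhase L M β (i', kv) (Xu j).1.1.2 (gridTime β (2 * (2 * M)) (Xu j).1.1.1) : ℝ) : ℂ) * Complex.I) =
            Complex.exp (-(((∑ l, latticeMomentum L kv l * (((Xu j).1.1.2 l).val : ℝ) : ℝ) : ℂ) * Complex.I)) *
              Complex.exp (((∑ l, latticeMomentum L kv l * (((Xb i).1.1.2 l).val : ℝ) : ℝ) : ℂ) * Complex.I) *
              Complex.exp (-((matsubaraFreq β M i' *
                (gridTime β (2 * (2 * M)) (Xu j).1.1.1 - gridTime β (2 * (2 * M)) (Xb i).1.1.1) : ℝ) : ℂ) * Complex.I) := by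
          rw [← Complex.exp_add, ← Complex.exp_add]
          congr 1
          simp only [vertexPhase]
          push_cast
          ring
        rw [hexp]
        simp only [hea, heb]
        have hd := hden i' kv
        push_cast
        field_simp
      rw [hsum]
      ring
    · rw [if_neg hσ, if_neg (fun h => hσ h.symm)]
      simp
  -- (3) the matrix is the transpose of lit g8's form
  set T : Matrix (Fin a) (Fin a) ℂ := Matrix.of fun a' b' : Fin a => ∑ m, Ff a' m * Gf b' m *
    (((1 / β : ℝ) : ℂ) * ∑ i' : MatsubaraIdx M,
      Complex.exp (-((matsubaraFreq β M i' *
        (gridTime β (2 * (2 * M)) ((fun a' => (Xu a').1.1.1) a') - gridTime β (2 * (2 * M)) ((fun b' => (Xb b').1.1.1) b')) :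
          ℝ) : ℂ) * Complex.I) *
          (1 / (-((matsubaraFreq β M i' : ℝ) : ℂ) * Complex.I + (ξ m : ℂ)) + r m i')) with hTdef
  have hmat : (Matrix.of fun i j : Fin a => ((⟪u i, u' j⟫_ℝ : ℝ) : ℂ) *
      contr ℂ ((gridSubMatrix L M β (fun q : GridPoint L (2 * (2 * M)) => q.2) (fun q => gridTime β (2 * (2 * M)) q.1)).transpose *
        normalCovariance L M p *
        gridSubMatrix L M β (fun q : GridPoint L (2 * (2 * M)) => q.2) (fun q => gridTime β (2 * (2 * M)) q.1)) (Xb i) (Xu j)) =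
      T.transpose := by
    ext i j
    rw [Matrix.transpose_apply, Matrix.of_apply, hT i j, hTdef, Matrix.of_apply]
  -- (4) the row weights
  set Wk : TorusSite 2 L → ℝ := fun kv => 7 + 1 / β * ∑ i', ‖r0 kv i'‖ with hWk
  have hWdef : ∀ m : (TorusSite 2 L × Fin 2) × Fin n, 7 + 1 / β * ∑ i', ‖r m i'‖ = Wk m.1.1 := by
    intro m
    simp only [hWk, hr]
  have hWk0 : ∀ kv, 0 ≤ Wk kv := fun kv => by
    simp only [hWk]
    exact add_nonneg (by norm_num) (mul_nonneg (by positivity) (sum_nonneg fun i' _ => norm_nonneg _))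
  have hWsum : (1 / (L : ℝ) ^ 2) * ∑ kv, Wk kv ≤ 7 + κ ^ 2 := by
    have hIR' : 1 / (β * (L : ℝ) ^ 2) * ∑ k : FreqMomentum L M, ‖r0 k.2 k.1‖ ≤ κ ^ 2 := by
      simpa only [hr0] using hIR
    have hcard : (Fintype.card (TorusSite 2 L) : ℝ) = (L : ℝ) ^ 2 := by
      rw [Fintype.card_pi, Fin.prod_const, ZMod.card]
      push_cast
      ring
    have hsplit : (1 / (L : ℝ) ^ 2) * ∑ kv, Wk kv = 7 + 1 / (β * (L : ℝ) ^ 2) * ∑ k : FreqMomentum L M, ‖r0 k.2 k.1‖ := by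
      simp only [hWk]
      rw [sum_add_distrib, sum_const, card_univ, ← mul_sum, Fintype.sum_prod_type, sum_comm]
      rw [nsmul_eq_mul, hcard, mul_add]
      congr 1
      · field_simp
      · ring
    rw [hsplit]
    linarith
  have hFrow : ∀ j, ∑ m, ‖Ff j m‖ ^ 2 * (7 + 1 / β * ∑ i', ‖r m i'‖) ≤ 7 + κ ^ 2 := by
    intro j
    simp only [hWdef, hFf, norm_neg, one_mul]
    rw [sum_norm_sq_mode_mul_weight_eq (Xu j).1.2 (ea j) (fun kv => ?_) (u' j) Wk]
    · have hu2 : ‖u' j‖ ^ 2 ≤ 1 := pow_le_one₀ (norm_nonneg _) (hu' j)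
      calc ‖u' j‖ ^ 2 * ((1 / (L : ℝ) ^ 2) * ∑ kv, Wk kv) ≤ 1 * (7 + κ ^ 2) :=
            mul_le_mul hu2 hWsum (mul_nonneg (by positivity) (sum_nonneg fun kv _ => hWk0 kv)) zero_le_one
        _ = 7 + κ ^ 2 := one_mul _
    · simp only [hea]
      rw [norm_mul, Complex.norm_exp, Complex.norm_real, Real.norm_eq_abs]
      simp
  have hGrow : ∀ i, ∑ m, ‖Gf i m‖ ^ 2 * (7 + 1 / β * ∑ i', ‖r m i'‖) ≤ 7 + κ ^ 2 := by
    intro i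
    simp only [hWdef, hGf]
    rw [sum_norm_sq_mode_mul_weight_eq (Xb i).1.2 (eb i) (fun kv => ?_) (u i) Wk]
    · have hu2 : ‖u i‖ ^ 2 ≤ 1 := pow_le_one₀ (norm_nonneg _) (hu i)
      calc ‖u i‖ ^ 2 * ((1 / (L : ℝ) ^ 2) * ∑ kv, Wk kv) ≤ 1 * (7 + κ ^ 2) :=
            mul_le_mul hu2 hWsum (mul_nonneg (by positivity) (sum_nonneg fun kv _ => hWk0 kv)) zero_le_one
        _ = 7 + κ ^ 2 := one_mul _
    · simp only [heb]
      rw [norm_mul, Complex.norm_exp_ofReal_mul_I, mul_one, Complex.norm_real, Real.norm_eq_abs]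
      simp
  -- (5) assemble
  have hdet := norm_det_truncatedPropagator_grid_add_symbol_le ξ hβ M r Ff Gf (fun a' => (Xu a').1.1.1) (fun b' => (Xb b').1.1.1)
  refine (congrArg (fun A : Matrix (Fin a) (Fin a) ℂ => ‖A.det‖) hmat).trans_le ?_
  rw [Matrix.det_transpose]
  refine hdet.trans ?_
  have h2 : ∀ j, Real.sqrt (2 * ∑ m, ‖Ff j m‖ ^ 2 * (7 + 1 / β * ∑ i', ‖r m i'‖)) ≤ Real.sqrt (2 * (7 + κ ^ 2)) := fun j =>
    Real.sqrt_le_sqrt (by linarith [hFrow j])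
  have h3 : ∀ i, Real.sqrt (2 * ∑ m, ‖Gf i m‖ ^ 2 * (7 + 1 / β * ∑ i', ‖r m i'‖)) ≤ Real.sqrt (2 * (7 + κ ^ 2)) := fun i =>
    Real.sqrt_le_sqrt (by linarith [hGrow i])
  calc (∏ a', Real.sqrt (2 * ∑ m, ‖Ff a' m‖ ^ 2 * (7 + 1 / β * ∑ i', ‖r m i'‖))) *
        ∏ b', Real.sqrt (2 * ∑ m, ‖Gf b' m‖ ^ 2 * (7 + 1 / β * ∑ i', ‖r m i'‖))
      ≤ (∏ _a' : Fin a, Real.sqrt (2 * (7 + κ ^ 2))) * ∏ _b' : Fin a, Real.sqrt (2 * (7 + κ ^ 2)) :=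
        mul_le_mul (prod_le_prod (fun _ _ => Real.sqrt_nonneg _) fun j _ => h2 j)
          (prod_le_prod (fun _ _ => Real.sqrt_nonneg _) fun i _ => h3 i) (prod_nonneg fun _ _ => Real.sqrt_nonneg _)
          (prod_nonneg fun _ _ => Real.sqrt_nonneg _)
    _ = Real.sqrt (2 * (7 + κ ^ 2)) ^ a * Real.sqrt (2 * (7 + κ ^ 2)) ^ a := by
        rw [prod_const, card_univ, Fintype.card_fin]

end Main

end Literature.MathematicalPhysics.QuantumLattice

end
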